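import Literature.Analysis.ODE.YorkePeriodBound
import Literature.Analysis.Fourier.Wirtinger
import HarnessLib

/-!
# Proof of Yorke's period bound `p ≥ 2π/L`: `Yorke1969_periodBound_holds`

This file discharges the named fact `Literature.Analysis.ODE.Yorke1969_periodBound`
(`YorkePeriodBound.lean`): a nonconstant `p`-periodic solution of `x' = F(x)` with `F`
`L`-Lipschitz (Euclidean norm) on a set `Ω ⊆ ℝⁿ` containing the orbit has `p ≥ 2π/L`
(J. A. Yorke, Proc. Amer. Math. Soc. 22 (1969) 509–512, Theorem, p. 509).

## The printed proof and the road taken here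

Yorke (pp. 509–511) argues: `f = F ∘ x = x'` is Lipschitz in `t`, hence a.e. differentiable with
`‖f'‖ ≤ L‖f‖` (his (4)); the unit tangent `y = f/‖f‖` then has `‖y'‖ ≤ L` a.e. (his (5)); and
the Lemma (6), `∫₀ᵖ ‖y'‖ dt ≥ 2π` (the unit tangent of a closed `C¹` curve turns by at least `2π`,
a Fenchel–Borsuk–Milnor type statement proved there by a hemisphere argument), gives
`2π ≤ ∫₀ᵖ ‖y'‖ ≤ Lp`.

Mathlib has neither the turning-tangent lemma nor arc length on the sphere, so we prove the SAME
statement by the classical Hilbert-space road (Wirtinger's inequality, Hardy–Littlewood–Pólya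
Thm 258, which the tree has PROVED as `Literature.Analysis.Fourier.wirtinger`), arranged so that
no second derivative and no a.e.-calculus is needed (documented deviation from the printed proof):

* (`rescale`) `y(t) = x(tp)` solves `y' = G(y)` with `G = p • F`, which is `pL`-Lipschitz on `Ω`,
  and `y` is `1`-periodic; it suffices to show `2π ≤ K` for a `1`-periodic nonconstant solution of
  a field with real Lipschitz constant `K` on `Ω` (`two_pi_le_of_periodic_one`).
* (the chord) nonconstancy gives `t₀, h` with `y(t₀ + h) ≠ y(t₀)`. The chord
  `w(t) = y(t + h) − y(t)` is `C¹` with `w' = G(y(· + h)) − G(y(·))` continuous, and the Lipschitz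
  bound on `Ω` reads POINTWISE `‖w'(t)‖ ≤ K‖w(t)‖` (this replaces Yorke's (4), `‖f'‖ ≤ L‖f‖` a.e.);
  `w(1) = w(0)` and `∫₀¹ w = ∫ₕ^{1+h} y − ∫₀¹ y = 0` by periodicity.
* (`four_pi_sq_mul_integral_norm_sq_le`) Wirtinger applied to each coordinate `t ↦ (w(t))ᵢ`
  (viewed in `ℂ`) and summed over `i` (`‖v‖² = Σᵢ vᵢ²` in `EuclideanSpace ℝ (Fin n)`):
  `4π² ∫₀¹ ‖w‖² ≤ ∫₀¹ ‖w'‖² ≤ K² ∫₀¹ ‖w‖²`.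
* `∫₀¹ ‖w‖² = ∫_{t₀}^{t₀+1} ‖w‖² > 0` since `w` is continuous with `w(t₀) ≠ 0`; hence `4π² ≤ K²`,
  `2π ≤ K = pL`, i.e. `2π/L ≤ p` (for `L = 0` the conclusion `2π/0 = 0 ≤ p` is immediate).

## References

* J. A. Yorke, *Periods of periodic solutions and the Lipschitz constant*, Proc. Amer. Math. Soc.
  22 (1969) 509–512, doi:10.1090/s0002-9939-1969-0245916-7 — Theorem, p. 509; proof pp. 509–511
  (read from the held text). [cite: Yorke1969, Theorem (p. 509)]
* G. H. Hardy, J. E. Littlewood, G. Pólya, *Inequalities*, 2nd ed., CUP 1952, §7.7, Thm 258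
  (Wirtinger's inequality) — used through `Literature.Analysis.Fourier.wirtinger`.
-/

noncomputable section

open _root_.MeasureTheory Set Filter intervalIntegral

namespace Literature.Analysis.ODE

namespace Yorke1969

variable {n : ℕ}

/-- **Vector Wirtinger inequality on `[0, 1]`.** For `w : ℝ → ℝⁿ` with continuous derivative
`w'`, `w 1 = w 0` and `∫₀¹ w = 0`: `4π² ∫₀¹ ‖w‖² ≤ ∫₀¹ ‖w'‖²`. Proof: the scalar zero-mean
Wirtinger inequality `Literature.Analysis.Fourier.wirtinger` for each coordinate
`t ↦ ((w t) i : ℂ)`, summed over `i` using `‖v‖² = Σᵢ (v i)²`. [folklore] -/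
theorem four_pi_sq_mul_integral_norm_sq_le {w w' : ℝ → EuclideanSpace ℝ (Fin n)}
    (hw : ∀ t, HasDerivAt w (w' t) t) (hw' : Continuous w') (hper : w 1 = w 0)
    (hmean : ∫ t in (0 : ℝ)..1, w t = 0) :
    4 * Real.pi ^ 2 * ∫ t in (0 : ℝ)..1, ‖w t‖ ^ 2 ≤ ∫ t in (0 : ℝ)..1, ‖w' t‖ ^ 2 := by
  have hwc : Continuous w := continuous_iff_continuousAt.mpr fun t => (hw t).continuousAt
  -- coordinatewise Wirtinger
  have key : ∀ i : Fin n, 4 * Real.pi ^ 2 * ∫ t in (0 : ℝ)..1, ‖((w t i : ℝ) : ℂ)‖ ^ 2 ≤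
      ∫ t in (0 : ℝ)..1, ‖((w' t i : ℝ) : ℂ)‖ ^ 2 := by
    intro i
    have hd : ∀ t, HasDerivAt (fun t => ((w t i : ℝ) : ℂ)) ((w' t i : ℝ) : ℂ) t := by
      intro t
      have h1 : HasDerivAt (fun t => w t i) (w' t i) t :=
        (EuclideanSpace.proj i : EuclideanSpace ℝ (Fin n) →L[ℝ] ℝ).hasFDerivAt.comp_hasDerivAt
          t (hw t)
      exact h1.ofReal_comp
    have hc : Continuous fun t => ((w' t i : ℝ) : ℂ) :=
      Complex.continuous_ofReal.comp ((PiLp.continuous_apply 2 _ i).comp hw')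
    have hp : (fun t => ((w t i : ℝ) : ℂ)) 1 = (fun t => ((w t i : ℝ) : ℂ)) 0 := by
      simp only [hper]
    have hm : ∫ t in (0 : ℝ)..1, ((w t i : ℝ) : ℂ) = 0 := by
      rw [intervalIntegral.integral_ofReal]
      have h2 : ∫ t in (0 : ℝ)..1, w t i = (∫ t in (0 : ℝ)..1, w t) i :=
        (EuclideanSpace.proj i : EuclideanSpace ℝ (Fin n) →L[ℝ] ℝ).intervalIntegral_comp_comm
          (hwc.intervalIntegrable (μ := volume) 0 1)
      rw [h2, hmean]
      simp
    exact Literature.Analysis.Fourier.wirtinger hd hc hp hm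
  -- sum over the coordinates
  have hnorm : ∀ v : EuclideanSpace ℝ (Fin n), ‖v‖ ^ 2 = ∑ i, ‖((v i : ℝ) : ℂ)‖ ^ 2 := by
    intro v
    rw [EuclideanSpace.real_norm_sq_eq]
    refine Finset.sum_congr rfl fun i _ => ?_
    rw [Complex.norm_real, Real.norm_eq_abs, sq_abs]
  have hL : ∫ t in (0 : ℝ)..1, ‖w t‖ ^ 2 = ∑ i, ∫ t in (0 : ℝ)..1, ‖((w t i : ℝ) : ℂ)‖ ^ 2 := by
    rw [← intervalIntegral.integral_finsetSum]
    · exact intervalIntegral.integral_congr fun t _ => hnorm (w t)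
    · intro i _
      exact ((Complex.continuous_ofReal.comp ((PiLp.continuous_apply 2 _ i).comp hwc)).norm.pow
        2).intervalIntegrable _ _
  have hR : ∫ t in (0 : ℝ)..1, ‖w' t‖ ^ 2 = ∑ i, ∫ t in (0 : ℝ)..1, ‖((w' t i : ℝ) : ℂ)‖ ^ 2 := by
    rw [← intervalIntegral.integral_finsetSum]
    · exact intervalIntegral.integral_congr fun t _ => hnorm (w' t)
    · intro i _
      exact ((Complex.continuous_ofReal.comp ((PiLp.continuous_apply 2 _ i).comp hw')).norm.pow
        2).intervalIntegrable _ _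
  rw [hL, hR, Finset.mul_sum]
  exact Finset.sum_le_sum fun i _ => key i

/-- **The normalised case (period `1`, real Lipschitz constant).** If `G` satisfies
`‖G a − G b‖ ≤ K‖a − b‖` on `Ω`, and `y : ℝ → ℝⁿ` is a nonconstant solution of `y' = G(y)` with
values in `Ω` and `y (t + 1) = y t`, then `2π ≤ K`. This is Yorke's theorem for `p = 1`, proved
by Wirtinger's inequality applied to the chord `w(t) = y(t + h) − y(t)`, for which the Lipschitz
bound gives `‖w'‖ ≤ K‖w‖` pointwise. [cite: Yorke1969, Theorem (p. 509)] -/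
theorem two_pi_le_of_periodic_one {Ω : Set (EuclideanSpace ℝ (Fin n))}
    {G : EuclideanSpace ℝ (Fin n) → EuclideanSpace ℝ (Fin n)} {K : ℝ}
    (hG : ∀ a ∈ Ω, ∀ b ∈ Ω, ‖G a - G b‖ ≤ K * ‖a - b‖)
    {y : ℝ → EuclideanSpace ℝ (Fin n)} (hΩ : ∀ t, y t ∈ Ω)
    (hy : ∀ t, HasDerivAt y (G (y t)) t) (hper : ∀ t, y (t + 1) = y t)
    (hnc : ∃ s t, y s ≠ y t) : 2 * Real.pi ≤ K := by
  obtain ⟨s₀, t₀, hst⟩ := hnc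
  set h : ℝ := s₀ - t₀ with hh
  -- the chord and its derivative
  set w : ℝ → EuclideanSpace ℝ (Fin n) := fun t => y (t + h) - y t with hw_def
  set w' : ℝ → EuclideanSpace ℝ (Fin n) := fun t => G (y (t + h)) - G (y t) with hw'_def
  have hyc : Continuous y := continuous_iff_continuousAt.mpr fun t => (hy t).continuousAt
  have hGy : Continuous fun t => G (y t) := by
    -- continuity of `G ∘ y` from the Lipschitz bound on `Ω` (all `y t` lie in `Ω`)
    refine continuous_iff_continuousAt.mpr fun t => ?_
    have h0 : Tendsto (fun s => ‖y s - y t‖) (nhds t) (nhds 0) :=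
      tendsto_iff_norm_sub_tendsto_zero.mp (hyc.tendsto t)
    have h1 : Tendsto (fun s => K * ‖y s - y t‖) (nhds t) (nhds 0) := by
      simpa using h0.const_mul K
    exact tendsto_iff_norm_sub_tendsto_zero.mpr
      (squeeze_zero (fun s => norm_nonneg _) (fun s => hG _ (hΩ s) _ (hΩ t)) h1)
  have hw : ∀ t, HasDerivAt w (w' t) t := by
    intro t
    exact ((hy (t + h)).comp_add_const t h).sub (hy t)
  have hw'c : Continuous w' := (hGy.comp (continuous_add_const h)).sub hGy
  have hwc : Continuous w := continuous_iff_continuousAt.mpr fun t => (hw t).continuousAt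
  -- pointwise `‖w'‖ ≤ K ‖w‖`
  have hbound : ∀ t, ‖w' t‖ ≤ K * ‖w t‖ := fun t => hG _ (hΩ _) _ (hΩ _)
  -- periodicity of the chord and zero mean
  have hyper : Function.Periodic y 1 := hper
  have hwper : Function.Periodic w 1 := by
    intro t
    simp only [hw_def]
    rw [show t + 1 + h = t + h + 1 by ring, hper, hper]
  have hw10 : w 1 = w 0 := by simpa using hwper 0
  have hmean : ∫ t in (0 : ℝ)..1, w t = 0 := by
    have hyh : Continuous fun t => y (t + h) := hyc.comp (continuous_add_const h)
    have hi1 : IntervalIntegrable (fun t => y (t + h)) volume 0 1 := hyh.intervalIntegrable _ _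
    have hi2 : IntervalIntegrable y volume 0 1 := hyc.intervalIntegrable _ _
    have hshift : ∫ t in (0 : ℝ)..1, y (t + h) = ∫ t in (0 : ℝ)..1, y t := by
      rw [intervalIntegral.integral_comp_add_right, zero_add, show (1 : ℝ) + h = h + 1 by ring,
        hyper.intervalIntegral_add_eq h 0, zero_add]
    simp only [hw_def]
    rw [intervalIntegral.integral_sub hi1 hi2, hshift, sub_self]
  -- Wirtinger for the chord, and the Lipschitz upper bound
  have hWirt := four_pi_sq_mul_integral_norm_sq_le hw hw'c hw10 hmean
  have hK : 0 ≤ K := by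
    have := hbound t₀
    have hwt : 0 < ‖w t₀‖ := by
      simp only [hw_def, hh, norm_pos_iff, sub_ne_zero, show t₀ + (s₀ - t₀) = s₀ by ring]
      exact hst
    nlinarith [norm_nonneg (w' t₀)]
  have hupper : ∫ t in (0 : ℝ)..1, ‖w' t‖ ^ 2 ≤ K ^ 2 * ∫ t in (0 : ℝ)..1, ‖w t‖ ^ 2 := by
    rw [← intervalIntegral.integral_const_mul]
    refine intervalIntegral.integral_mono_on zero_le_one
      ((hw'c.norm.pow 2).intervalIntegrable _ _)
      ((continuous_const.mul (hwc.norm.pow 2)).intervalIntegrable _ _) fun t _ => ?_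
    have h1 := hbound t
    have h2 : 0 ≤ ‖w' t‖ := norm_nonneg _
    calc ‖w' t‖ ^ 2 ≤ (K * ‖w t‖) ^ 2 := pow_le_pow_left₀ h2 h1 2
      _ = K ^ 2 * ‖w t‖ ^ 2 := by ring
  -- the integral of `‖w‖²` over a period is positive
  have hpos : 0 < ∫ t in (0 : ℝ)..1, ‖w t‖ ^ 2 := by
    have hpersq : Function.Periodic (fun t => ‖w t‖ ^ 2) 1 := fun t => by
      simp only [hwper t]
    have hmove : ∫ t in (0 : ℝ)..1, ‖w t‖ ^ 2 = ∫ t in t₀..t₀ + 1, ‖w t‖ ^ 2 := by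
      simpa using hpersq.intervalIntegral_add_eq 0 t₀
    rw [hmove]
    have hwt : 0 < ‖w t₀‖ ^ 2 := by
      refine pow_pos ?_ 2
      simp only [hw_def, hh, norm_pos_iff, sub_ne_zero, show t₀ + (s₀ - t₀) = s₀ by ring]
      exact hst
    have := intervalIntegral.integral_lt_integral_of_continuousOn_of_le_of_exists_lt
      (f := fun _ => (0 : ℝ)) (g := fun t => ‖w t‖ ^ 2) (lt_add_one t₀) continuousOn_const
      (hwc.norm.pow 2).continuousOn (fun t _ => sq_nonneg _)
      ⟨t₀, left_mem_Icc.mpr (lt_add_one t₀).le, hwt⟩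
    simpa using this
  -- conclude `4π² ≤ K²`, hence `2π ≤ K`
  have hsq : 4 * Real.pi ^ 2 ≤ K ^ 2 := by
    have := hWirt.trans hupper
    nlinarith
  by_contra hlt
  push Not at hlt
  nlinarith [mul_pos (sub_pos.mpr hlt) (add_pos_of_nonneg_of_pos hK Real.two_pi_pos)]

end Yorke1969

open Yorke1969 in
/-- **Yorke's period bound holds** (Yorke 1969, Theorem, p. 509): discharge of the named fact
`Yorke1969_periodBound`. Rescale time to period `1` (`y(t) = x(tp)`, field `p • F`, Lipschitz
constant `pL` on `Ω`) and apply `Yorke1969.two_pi_le_of_periodic_one`: `2π ≤ pL`, i.e.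
`2π/L ≤ p` (trivial when `L = 0`). [cite: Yorke1969, Theorem (p. 509)] -/
theorem Yorke1969_periodBound_holds : Yorke1969_periodBound := by
  intro n Ω F L hF x p hp hΩ hx hper hnc
  -- the rescaled solution `y t = x (t * p)` of `y' = p • F (y)`
  set y : ℝ → EuclideanSpace ℝ (Fin n) := fun t => x (t * p) with hy_def
  have hy : ∀ t, HasDerivAt y ((fun z => (p : ℝ) • F z) (y t)) t := by
    intro t
    have := (hx (t * p)).scomp t (hasDerivAt_mul_const p)
    simpa [hy_def, Function.comp_def] using this
  have hG : ∀ a ∈ Ω, ∀ b ∈ Ω, ‖(p : ℝ) • F a - (p : ℝ) • F b‖ ≤ (p * L) * ‖a - b‖ := by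
    intro a ha b hb
    rw [← smul_sub, norm_smul, Real.norm_of_nonneg hp.le, mul_assoc]
    exact mul_le_mul_of_nonneg_left (lipschitzOnWith_iff_norm_sub_le.mp hF ha hb) hp.le
  have hyΩ : ∀ t, y t ∈ Ω := fun t => hΩ _
  have hyper : ∀ t, y (t + 1) = y t := by
    intro t
    simp only [hy_def, add_mul, one_mul]
    exact hper _
  have hync : ∃ s t, y s ≠ y t := by
    obtain ⟨s, t, hst⟩ := hnc
    refine ⟨s / p, t / p, ?_⟩
    simp only [hy_def, div_mul_cancel₀ _ hp.ne']
    exact hst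
  have hmain : 2 * Real.pi ≤ p * L := two_pi_le_of_periodic_one hG hyΩ hy hyper hync
  rcases eq_or_lt_of_le L.coe_nonneg with hL | hL
  · rw [← hL, div_zero]
    exact hp.le
  · rw [div_le_iff₀ hL]
    exact hmain

/-- **Deprecated alias — bookkeeping only; use `Yorke1969_periodBound`.** Yorke's period bound
(an autonomous system `x' = F(x)` with `F` `L`-Lipschitz has no nonconstant periodic orbit of
period `< 2π/L`) was first vendored under THIS name, `Literature.Analysis.ODE.yorke_period_bound`
(the key under which the literature debt queue filed it, with 3 dependents, and under which
`Literature/Analysis/FluidPDE/VorticityTransportFormula.lean` still mentions it), and was renamed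
in the tree to `Yorke1969_periodBound` on 2026-08-15 with the identical statement (up to unfolding
`Function.Periodic x p` to `∀ t, x (t + p) = x t`). This alias restores the original name so that
both names denote one and the same (discharged) fact; it is *definitionally* `Yorke1969_periodBound`
and introduces no new statement. [cite: Yorke1969, Theorem (p. 509)] -/
def yorke_period_bound : Prop := Yorke1969_periodBound

/-- **Yorke's period bound holds — discharge under the fact's original name.** Definitionally
`Yorke1969_periodBound_holds`, which new code should use directly.
[cite: Yorke1969, Theorem (p. 509)] -/
theorem yorke_period_bound_holds : yorke_period_bound := Yorke1969_periodBound_holds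

end Literature.Analysis.ODE

end
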